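import Literature.Barriers.CriticalPhenomena.RigorousRGSmallParameterLocProperties
import Literature.Barriers.CriticalPhenomena.RigorousRGSmallParameterPolymerGas
import HarnessLib

/-!
# `RigorousRGSmallParameter` (Slade, Theorem 1.4.1): `Loc_X = Σ_{B ∈ ℬ(X)} Loc_{X,B}` and the
# Map-1 transfer `J(X,B) = Loc_{X,B} I^{-X} K(X)` of [BS-rg-step] §4.2 with its cancellation (4.2)

Companion ("proof architecture") file of
`Literature/Barriers/CriticalPhenomena/RigorousRGSmallParameter.lean`. Map 1 of the
renormalisation group step behind Slade's Theorem 6.3.1 (iterated in the named fact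
`Slade2017_prop822`) is Brydges' change of variables (`…KChangeOfVariables.kout`) applied with the
transfer of [BS-rg-step] §4.2: "we define `J(X,B) = 0` if `(X,B) ∉ 𝒟(J)` and
`J(X,B) = Loc_{X,B} I^{-X} K(X)` for `X ∈ 𝒮` with `X ⊋ B` (4.21), and to achieve the cancellation
condition imposed by (4.2) [`Σ_{U:(U,B)∈𝒟(J)} J(U,B) = 0`], we are forced to define
`J(B,B) = -Σ_{Y ∈ 𝒮 : Y ⊋ B} Loc_{Y,B} I^{-Y} K(Y)` (4.22). With these definitions … it then follows
from (4.5) and `Σ_{B ⊂ X} Loc_{X,B} = Loc_X` (the latter due to [BS-rg-loc]) that [(4.23)]".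
Here `Loc_{X,Y}` is [BS-rg-loc] Definition 1.7.1 (`locXY` of `…LocProperties`), and
`I^{-X} = 1/I^X` (`(blockProd b I X)⁻¹`, pointwise).

## What this file provides (all proved; definitions with their printed properties)

* `phatX_union/empty/biUnion`, **`sum_blocksOf_locXY`** (`Loc_X = Σ_{B ∈ ℬ_j(X)} Loc_{X,B}` for a
  `j`-polymer `X`), `contDiff_locXY`, **`dependsOn_locXY`** (`Loc_{X,Y}F ∈ 𝒩(U)` when `U`
  contains the reach `⌊d_+⌋` of `Y` — the field locality (4.3) of `J` "in its `B` argument");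
* `basePt`, `smallSupersets` (`{Y ∈ 𝒮 : Y ⊋ B}`), `locPiece` (`Loc_{Y,B} I^{-Y}K(Y)`),
  **`mapOneJ`** ((4.21)–(4.22)), **`mapOneJ_support`** (`J = 0` off `𝒟(J)`),
  **`mapOneJ_self_add_sum`** / **`sum_mapOneJ_eq_zero`** (the cancellation (4.2)),
  `contDiff_mapOneJ`, **`dependsOn_mapOneJ`**.

Not treated here: base-point independence of `J` (Proposition 1.3.1 (iii) of [BS-rg-loc],
`locX_base_change`, under the coordinate-patch condition), the symmetry properties of `J`, and
the norm estimate (JCK0).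

Sources: D. C. Brydges, G. Slade, J. Stat. Phys. 159 (2015) 589–667, arXiv:1403.7256, §4.1
((4.1)–(4.3)), §4.2 ((4.21)–(4.23)); Brydges–Slade II (BS-rg-loc), J. Stat. Phys. 159 (2015)
461–491, arXiv:1403.7253, Definition 1.7.1 and the display after it.

## References

* [BrydgesSlade2015RGII] D. C. Brydges, G. Slade, *A renormalisation group method. II.
  Approximation by local polynomials*, J. Stat. Phys. **159** (2015) 461–491, arXiv:1403.7253.
* [BrydgesSlade2015RGV] D. C. Brydges, G. Slade, *A renormalisation group method. V. A single
  renormalisation group step*, J. Stat. Phys. **159** (2015) 589–667, arXiv:1403.7256.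
-/

noncomputable section

namespace Literature.Barriers.CriticalPhenomena

namespace LongRangePhi4

namespace Loc

open Finset Tphi RGNorm LocalPoly Polymer Literature.Probability.LatticeModels Matrix
open scoped ContDiff

variable {d M n : ℕ} [NeZero M]

/-! ### `Loc_{X,Y}` -/

/-- `P̂_m(Y ∪ Z) = P̂_m(Y) + P̂_m(Z)` for disjoint `Y, Z`. [folklore] -/
theorem phatX_union (m' : List (Fin n × List (Fin d))) {Y Z : Finset (TorusSite d M)} (h : Disjoint Y Z) :
    phatX m' (Y ∪ Z) = phatX m' Y + phatX m' Z := by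
  funext φ
  simp only [phatX, Pi.add_apply, Finset.sum_union h]

/-- `P̂_m(∅) = 0`. [folklore] -/
@[simp] theorem phatX_empty (m' : List (Fin n × List (Fin d))) : phatX m' (∅ : Finset (TorusSite d M)) = 0 := by
  funext φ; simp [phatX]

/-- `P̂_m` over a union of pairwise disjoint sets is the sum. [folklore] -/
theorem phatX_biUnion (m' : List (Fin n × List (Fin d))) {ι : Type*} [DecidableEq ι] (s : Finset ι)
    (f : ι → Finset (TorusSite d M)) (h : (s : Set ι).PairwiseDisjoint f) :
    phatX m' (s.biUnion f) = ∑ i ∈ s, phatX m' (f i) := by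
  funext φ
  simp only [phatX, Finset.sum_apply, Finset.sum_biUnion h]

/-- **`Loc_X = Σ_{B ∈ ℬ(X)} Loc_{X,B}`** for a polymer `X` (the partition into blocks; used in Map 1 as
"`Σ_{B ⊂ X} Loc_{X,B} = Loc_X`"). [cite: BrydgesSlade2015RGII, §1.7 (display after Definition 1.7.1)] [cite: BrydgesSlade2015RGV, §4.2 ("Σ_{B⊂X} Loc_{X,B} = Loc_X (the latter due to [BS-rg-loc])")] -/
theorem sum_blocksOf_locXY (pN : ℕ) (dφ dplus : ℝ) (a : TorusSite d M) {b : ℕ} {X : Finset (TorusSite d M)}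
    (hX : IsPolymer b X) (F : (TorusSite d M → Fin n → ℝ) → ℝ) :
    ∑ B ∈ blocksOf b X, locXY pN dφ dplus a X B F = locX pN dφ dplus a X F := by
  classical
  have hpd : ((blocksOf b X : Finset (Finset (TorusSite d M))) : Set (Finset (TorusSite d M))).PairwiseDisjoint id := by
    intro B₁ h₁ B₂ h₂ hne
    obtain ⟨x₁, -, rfl⟩ := exists_eq_block_of_mem_blocksOf h₁
    obtain ⟨x₂, -, rfl⟩ := exists_eq_block_of_mem_blocksOf h₂
    simp only [Function.onFun, id_eq]
    rw [Finset.disjoint_left]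
    intro y hy₁ hy₂
    exact hne (by rw [← block_eq_of_mem hy₁, ← block_eq_of_mem hy₂])
  have h1 : ∑ B ∈ blocksOf b X, locXY pN dφ dplus a X B F = locXY pN dφ dplus a X ((blocksOf b X).biUnion id) F := by
    funext φ
    simp only [locXY, Finset.sum_apply, phatX_biUnion _ _ id hpd, id_eq, Finset.mul_sum]
    rw [Finset.sum_comm]
  rw [h1, ← hX.eq_biUnion, locXY_self]

/-- `Loc_{X,Y} F` is smooth. [folklore] -/
theorem contDiff_locXY (pN : ℕ) (dφ dplus : ℝ) (a : TorusSite d M) (X Y : Finset (TorusSite d M))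
    (F : (TorusSite d M → Fin n → ℝ) → ℝ) : ContDiff ℝ ∞ (locXY pN dφ dplus a X Y F) :=
  ContDiff.sum fun _ _ => contDiff_const.mul (contDiff_phatX _ Y)

/-- **`Loc_{X,Y} F ∈ 𝒩(U)` when `U` contains the reach `⌊d_+⌋` of every point of `Y`** (field
locality of `J(U,B) = Loc_{U,B}(⋯)` "in its `B` argument", [BS-rg-step] (4.3)). [cite: BrydgesSlade2015RGV, §4.1 ((4.3): "J(U,B) ∈ 𝒩(B^□)")] -/
theorem dependsOn_locXY {pN : ℕ} {dφ dplus : ℝ} (hφ : 0 < dφ) {U X Y : Finset (TorusSite d M)}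
    (hK : 2 * ((⌊dplus⌋₊ : ℤ) + 1) < M) (hYU : ∀ y ∈ Y, reach y ⌊dplus⌋₊ ⊆ U) (a : TorusSite d M)
    (F : (TorusSite d M → Fin n → ℝ) → ℝ) : DependsOn U (locXY pN dφ dplus a X Y F) := by
  unfold locXY
  refine DependsOn.sum fun C _ => DependsOn.mul (fun _ _ _ => rfl) (dependsOn_phatX hK hYU _ ?_)
  exact (bounds_of_mem_vbarPlus (rep_mem_vbarPlus hφ C.2)).2

/-! ### The Map-1 transfer `J` for Slade's model -/

open Classical in
/-- The small sets strictly containing the block `B`: `{Y ∈ 𝒮 : Y ⊋ B}`. [cite: BrydgesSlade2015RGV, §4.2 ((4.22): "Y ∈ 𝒮 with Y ⊋ B")] -/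
def smallSupersets (b : ℕ) (B : Finset (TorusSite d M)) : Finset (Finset (TorusSite d M)) :=
  univ.filter fun Y => IsSmall b Y ∧ B ∈ blocksOf b Y ∧ Y ≠ B

/-- Membership in `smallSupersets`. [folklore] -/
@[simp] theorem mem_smallSupersets {b : ℕ} {B Y : Finset (TorusSite d M)} :
    Y ∈ smallSupersets b B ↔ IsSmall b Y ∧ B ∈ blocksOf b Y ∧ Y ≠ B := by
  classical
  simp [smallSupersets]

section MapOneJ

variable (b pN : ℕ) (dφ dplus : ℝ) (I K : Finset (TorusSite d M) → (TorusSite d M → Fin n → ℝ) → ℝ)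

/-- A base point for `Loc` on the block `B` (any point of `B`; `Loc_X` does not depend on the
choice by Proposition 1.3.1 (iii) of [BS-rg-loc], `locX_base_change`). [cite: BrydgesSlade2015RGII, Proposition 1.3.1 (iii)] -/
def basePt (B : Finset (TorusSite d M)) : TorusSite d M := if h : B.Nonempty then h.choose else 0

/-- The transferred piece `Loc_{Y,B} I^{-Y} K(Y)` ("for `X ∈ 𝒮 ∖ B` we wish to replace `K(X)` by
`K(X) - I^X Loc_X I^{-X}K(X)`"). [cite: BrydgesSlade2015RGV, §4.2 ((4.21)–(4.22))] -/
def locPiece (Y B : Finset (TorusSite d M)) : (TorusSite d M → Fin n → ℝ) → ℝ :=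
  locXY pN dφ dplus (basePt B) Y B ((blockProd b I Y)⁻¹ * K Y)

open Classical in
/-- **[BS-rg-step] Map 1, the transfer `J(X,B)`** ((4.21)–(4.22)): `J(X,B) = Loc_{X,B} I^{-X}K(X)`
for `X ∈ 𝒮` with `X ⊋ B`, `J(B,B) = -Σ_{Y ∈ 𝒮 : Y ⊋ B} Loc_{Y,B} I^{-Y}K(Y)`, and `J(X,B) = 0` if
`(X,B) ∉ 𝒟(J)`. [cite: BrydgesSlade2015RGV, §4.2 ((4.21): "J(X,B) = Loc_{X,B}I^{-X}K(X) for X ∈ 𝒮 with X ⊋ B"; (4.22): "J(B,B) = −Σ_{Y∈𝒮:Y⊋B} Loc_{Y,B}I^{-Y}K(Y)")] -/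
def mapOneJ (X B : Finset (TorusSite d M)) : (TorusSite d M → Fin n → ℝ) → ℝ :=
  if IsSmall b X ∧ B ∈ blocksOf b X ∧ X ≠ B then locPiece b pN dφ dplus I K X B
  else if X = B ∧ (∃ x, B = block b x) then -∑ Y ∈ smallSupersets b B, locPiece b pN dφ dplus I K Y B
  else 0

/-- **`J` is supported on `𝒟(J) = {(X,B) : X ∈ 𝒮, B ∈ ℬ(X)}`** ("`J(U,B) = 0` if `(U,B) ∉ 𝒟(J)`").
[cite: BrydgesSlade2015RGV, §4.1 ((4.1) and the sentence before (4.2))] -/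
theorem mapOneJ_support (X B : Finset (TorusSite d M)) (h : mapOneJ b pN dφ dplus I K X B ≠ 0) :
    IsSmall b X ∧ B ∈ blocksOf b X := by
  unfold mapOneJ at h
  split_ifs at h with h1 h2
  · exact ⟨h1.1, h1.2.1⟩
  · obtain ⟨rfl, x, rfl⟩ := h2
    exact ⟨isSmall_block b x, mem_image_of_mem _ (mem_block_self b x)⟩
  · exact absurd rfl h

/-- **The cancellation condition (4.2)**: `J(B,B) + Σ_{Y ∈ 𝒮 : Y ⊋ B} J(Y,B) = 0` for every block `B`
("to achieve the cancellation condition imposed by (4.2), we are forced to define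
`J(B,B) = -Σ_{Y ∈ 𝒮 : Y ⊋ B} Loc_{Y,B}I^{-Y}K(Y)`"). [cite: BrydgesSlade2015RGV, §4.1 ((4.2)) and §4.2 ((4.22))] -/
theorem mapOneJ_self_add_sum (x : TorusSite d M) :
    mapOneJ b pN dφ dplus I K (block b x) (block b x) +
      ∑ Y ∈ smallSupersets b (block b x), mapOneJ b pN dφ dplus I K Y (block b x) = 0 := by
  classical
  have hJB : mapOneJ b pN dφ dplus I K (block b x) (block b x) =
      -∑ Y ∈ smallSupersets b (block b x), locPiece b pN dφ dplus I K Y (block b x) := by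
    unfold mapOneJ
    rw [if_neg (by simp), if_pos ⟨rfl, x, rfl⟩]
  have hrest : ∑ Y ∈ smallSupersets b (block b x), mapOneJ b pN dφ dplus I K Y (block b x) =
      ∑ Y ∈ smallSupersets b (block b x), locPiece b pN dφ dplus I K Y (block b x) := by
    refine Finset.sum_congr rfl fun Y hY => ?_
    obtain ⟨hYs, hBY, hne⟩ := mem_smallSupersets.1 hY
    unfold mapOneJ
    rw [if_pos ⟨hYs, hBY, hne⟩]
  rw [hJB, hrest, neg_add_cancel]

open Classical in
/-- The same cancellation as a sum over `{U : (U,B) ∈ 𝒟(J)}`. [cite: BrydgesSlade2015RGV, §4.1 ((4.2))] -/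
theorem sum_mapOneJ_eq_zero (x : TorusSite d M) :
    ∑ U ∈ univ.filter (fun U => IsSmall b U ∧ block b x ∈ blocksOf b U), mapOneJ b pN dφ dplus I K U (block b x) = 0 := by
  have hmem : block b x ∈ univ.filter (fun U => IsSmall b U ∧ block b x ∈ blocksOf b U) := by
    simp only [Finset.mem_filter, Finset.mem_univ, true_and]
    exact ⟨isSmall_block b x, mem_image_of_mem _ (mem_block_self b x)⟩
  rw [← Finset.add_sum_erase _ _ hmem]
  have hset : (univ.filter (fun U => IsSmall b U ∧ block b x ∈ blocksOf b U)).erase (block b x) = smallSupersets b (block b x) := by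
    ext Y
    simp only [Finset.mem_erase, Finset.mem_filter, Finset.mem_univ, true_and, mem_smallSupersets]
    tauto
  rw [hset]
  exact mapOneJ_self_add_sum b pN dφ dplus I K x

/-- `J(X,B)` is smooth. [folklore] -/
theorem contDiff_mapOneJ (X B : Finset (TorusSite d M)) : ContDiff ℝ ∞ (mapOneJ b pN dφ dplus I K X B) := by
  unfold mapOneJ locPiece
  split_ifs
  · exact contDiff_locXY pN dφ dplus _ X B _
  · have h : ContDiff ℝ ∞ (fun φ => ∑ Y ∈ smallSupersets b B,
        locXY pN dφ dplus (basePt B) Y B ((blockProd b I Y)⁻¹ * K Y) φ) :=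
      ContDiff.sum fun Y _ => contDiff_locXY pN dφ dplus _ Y B _
    have e : (-∑ Y ∈ smallSupersets b B, locXY pN dφ dplus (basePt B) Y B ((blockProd b I Y)⁻¹ * K Y)) =
        fun φ => -(∑ Y ∈ smallSupersets b B, locXY pN dφ dplus (basePt B) Y B ((blockProd b I Y)⁻¹ * K Y) φ) := by
      funext φ; simp only [Pi.neg_apply, Finset.sum_apply]
    rw [e]
    exact h.neg
  · exact contDiff_const

/-- **Field locality of `J` in its `B` argument**: `J(X,B) ∈ 𝒩(U)` whenever `U` contains the reach
`⌊d_+⌋` of every point of `B` (so `J(X,B) ∈ 𝒩(B^□)` once `reach(y, ⌊d_+⌋) ⊆ B^□` for `y ∈ B`).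
[cite: BrydgesSlade2015RGV, §4.1 ((4.3): "J(U,B) obeys the field locality (in its B argument) … J(U,B) ∈ 𝒩(B^□)")] -/
theorem dependsOn_mapOneJ (hφ : 0 < dφ) (hK : 2 * ((⌊dplus⌋₊ : ℤ) + 1) < M) {U : Finset (TorusSite d M)}
    (X B : Finset (TorusSite d M)) (hBU : ∀ y ∈ B, reach y ⌊dplus⌋₊ ⊆ U) :
    DependsOn U (mapOneJ b pN dφ dplus I K X B) := by
  unfold mapOneJ locPiece
  split_ifs
  · exact dependsOn_locXY hφ hK hBU _ _
  · intro φ ψ hφψ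
    simp only [Pi.neg_apply, Finset.sum_apply]
    congr 1
    exact Finset.sum_congr rfl fun Y _ => dependsOn_locXY hφ hK hBU _ _ φ ψ hφψ
  · exact fun _ _ _ => rfl

end MapOneJ

end Loc

end LongRangePhi4

end Literature.Barriers.CriticalPhenomena
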